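import Mathlib.Topology.Order.IntermediateValue
import Mathlib.Topology.UniformSpace.HeineCantor
import Mathlib.Analysis.Normed.Group.Bounded
import Mathlib.Analysis.Normed.Module.RCLike.Real
import Literature.Barriers.AtomisticToContinuum.ShockFormationEnergy
import HarnessLib

/-!
# Sideris 1985, Theorem 1 — finite propagation speed (discharge of Sideris' Proposition)

Support file 4 for the discharge of
`Literature.Barriers.AtomisticToContinuum.ShockFormationBarrier` (Sideris, Comm. Math. Phys.
101 (1985), Thm. 1). We prove the named fact
`Literature.Barriers.AtomisticToContinuum.PolytropicEuler.FinitePropagationSpeed` (Sideris'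
Proposition, §1 p. 476: a `C¹` solution of (1.1 a–d) with rest data outside `{‖x‖ ≤ R}` stays at
rest on `‖x‖ ≥ R + σ t`, `σ` the far-field sound speed) by the local energy method:

* `rest_step`: if the solution is at rest on the backward cone `‖x - x₀‖ ≤ r₀ - σ' t` up to time
  `τ` (`σ' > σ`), it stays at rest a little longer — uniform continuity on the compact cone gives
  the speed bound `‖u‖ + c ≤ σ'` slightly beyond `τ`, the local energy inequality of
  `ShockFormationEnergy` and the Grönwall-type vanishing lemma give `E ≡ 0`, whence the rest
  state on the open slices and, by continuity, on the closed ones;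
* `rest_on_cone`: continuous induction in time (`IsClosed.Icc_subset_of_forall_mem_nhdsWithin`);
* `FinitePropagationSpeed_holds`: every point with `‖x‖ > R + σ t` is the tip of such a cone over
  rest data (any `σ' ∈ (σ, (‖x‖ - R)/t)`), and the boundary `‖x‖ = R + σ t` follows by continuity.

## Mathlib search

Heine–Cantor `IsCompact.uniformContinuousOn_of_continuous`, `Metric.uniformContinuousOn_iff`,
`IsCompact.exists_bound_of_continuousOn`, continuous induction
`IsClosed.Icc_subset_of_forall_mem_nhdsWithin`, `closure_ball`. No definitions in this file.

## References

* T. C. Sideris, Comm. Math. Phys. 101 (1985) 475–485, §1 Proposition p. 476 ("a consequence of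
  local energy estimates; see the proposition in [10]").
* T. C. Sideris, Arch. Rational Mech. Anal. 86 (1984) 369–381 (= [10]).
* F. John, *Partial Differential Equations*, 4th ed. (1982), Ch. 5 §3.
-/

noncomputable section

open Set Function Filter MeasureTheory Metric
open scoped RealInnerProductSpace Topology

namespace Literature.Barriers.AtomisticToContinuum.PolytropicEuler

open Literature.Analysis.FluidPDE Literature.Analysis.FluidPDE.VectorCalculus

/-! ### Two elementary lemmas -/

/-- A function continuous from the left at `τ` (within `[a, ∞)`, `a < τ`) which is constant on
`[a, τ)` takes the same value at `τ`. [folklore] -/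
theorem eq_of_eqOn_Ico {F : Type*} [TopologicalSpace F] [T2Space F] {f : ℝ → F} {a τ : ℝ} {c : F}
    (hf : ContinuousWithinAt f (Ici a) τ) (haτ : a < τ) (heq : ∀ t ∈ Ico a τ, f t = c) :
    f τ = c := by
  have h1 : Tendsto f (𝓝[Ico a τ] τ) (𝓝 (f τ)) := hf.mono_left (nhdsWithin_mono _ Ico_subset_Ici_self)
  have h2 : Tendsto f (𝓝[Ico a τ] τ) (𝓝 c) :=
    (tendsto_const_nhds (x := c)).congr' (eventually_nhdsWithin_of_forall fun t ht => (heq t ht).symm)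
  haveI : (𝓝[Ico a τ] τ).NeBot := by
    rw [← mem_closure_iff_nhdsWithin_neBot, closure_Ico haτ.ne]
    exact right_mem_Icc.2 haτ.le
  exact tendsto_nhds_unique h1 h2

/-- **Uniform speed margin near the rest state**: if `c(ρ̄, S̄) < σ'` then for states close to
`(ρ̄, 0, S̄)` the characteristic speeds stay below the cone speed, `‖u‖ + c(ρ, S) ≤ σ'`
(continuity of the sound speed). [folklore] -/
theorem exists_speed_margin {A γ ρbar Sbar σ' : ℝ} (hρbar : 0 < ρbar)
    (hσ : soundSpeed A γ ρbar Sbar < σ') :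
    ∃ ε > 0, ∀ (r s : ℝ) (v : E3), |r - ρbar| < ε → |s - Sbar| < ε → ‖v‖ < ε →
      ‖v‖ + soundSpeed A γ r s ≤ σ' := by
  set η := (σ' - soundSpeed A γ ρbar Sbar) / 2 with hη
  have hη0 : 0 < η := by rw [hη]; linarith
  have hcont : ContinuousAt (fun q : ℝ × ℝ => soundSpeed A γ q.1 q.2) (ρbar, Sbar) :=
    (continuousOn_soundSpeed A γ).continuousAt
      (((isOpen_lt continuous_const continuous_id).prod isOpen_univ).mem_nhds
        (mk_mem_prod (mem_setOf.2 hρbar) (mem_univ Sbar)))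
  obtain ⟨δ, hδ, hδε⟩ := Metric.continuousAt_iff.1 hcont η hη0
  refine ⟨min δ η, lt_min hδ hη0, fun r s v hr hs hv => ?_⟩
  have hd : dist (r, s) (ρbar, Sbar) < δ := by
    rw [Prod.dist_eq, max_lt_iff]
    exact ⟨lt_of_lt_of_le hr (min_le_left _ _), lt_of_lt_of_le hs (min_le_left _ _)⟩
  have h1 := hδε hd
  rw [Real.dist_eq, abs_lt] at h1
  have hv' : ‖v‖ < η := lt_of_lt_of_le hv (min_le_right _ _)
  simp only at h1
  linarith [h1.2]

/-! ### The cone lemma -/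

section Cone

variable {A γ ρbar Sbar : ℝ} {ρ : ℝ → E3 → ℝ} {u : ℝ → E3 → E3} {S : ℝ → E3 → ℝ}
variable {x₀ : E3} {r₀ σ' : ℝ}

/-- Joint continuity of `(t, x) ↦ div u(t)(x)` on `[0, ∞) × ℝ³` for a `C¹` solution. [folklore] -/
theorem continuousOn_divergence_velocity (h : IsPolytropicC1Solution A γ (Ici 0) ρ u S) :
    ContinuousOn (fun p : ℝ × E3 => divergence (u p.1) p.2) (Ici 0 ×ˢ univ) := by
  let b := stdOrthonormalBasis ℝ E3
  have hD := continuousOn_fderiv_slice_of_contDiffOn h.contDiffOn_velocity (uniqueDiffOn_Ici 0)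
  have : (fun p : ℝ × E3 => divergence (u p.1) p.2) =
      fun p => ∑ i, ⟪b i, fderiv ℝ (u p.1) p.2 (b i)⟫ :=
    funext fun p => divergence_eq_sum_inner_fderiv b (u p.1) p.2
  rw [this]
  exact continuousOn_finsetSum _ fun i _ =>
    continuousOn_const.inner (hD.clm_apply continuousOn_const)

/-- The set where the time-`t` slice is at rest is closed. [folklore] -/
theorem isClosed_restSet (h : IsPolytropicC1Solution A γ (Ici 0) ρ u S) {t : ℝ} (ht : 0 ≤ t) :
    IsClosed {x : E3 | ρ t x = ρbar ∧ u t x = 0 ∧ S t x = Sbar} := by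
  have hρ := (contDiff_slice_of_contDiffOn h.contDiffOn_density (mem_Ici.2 ht)).continuous
  have hu := (contDiff_slice_of_contDiffOn h.contDiffOn_velocity (mem_Ici.2 ht)).continuous
  have hS := (contDiff_slice_of_contDiffOn h.contDiffOn_entropy (mem_Ici.2 ht)).continuous
  exact (isClosed_eq hρ continuous_const).inter
    ((isClosed_eq hu continuous_const).inter (isClosed_eq hS continuous_const))

/-- Rest on an open ball extends to the closed ball (continuity in `x`). [folklore] -/
theorem rest_closedBall_of_ball (h : IsPolytropicC1Solution A γ (Ici 0) ρ u S) {t r : ℝ}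
    (ht : 0 ≤ t) (hr : 0 < r)
    (hrest : ∀ x, ‖x - x₀‖ < r → ρ t x = ρbar ∧ u t x = 0 ∧ S t x = Sbar) :
    ∀ x, ‖x - x₀‖ ≤ r → ρ t x = ρbar ∧ u t x = 0 ∧ S t x = Sbar := by
  intro x hx
  have hsub : ball x₀ r ⊆ {x : E3 | ρ t x = ρbar ∧ u t x = 0 ∧ S t x = Sbar} := fun y hy =>
    hrest y (by rwa [mem_ball, dist_eq_norm] at hy)
  have hcl := (isClosed_restSet (ρbar := ρbar) (Sbar := Sbar) h ht).closure_subset_iff.2 hsub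
  rw [closure_ball x₀ hr.ne'] at hcl
  exact hcl (by rwa [mem_closedBall, dist_eq_norm])

/-- **The induction step of the cone lemma.** Let `σ' > c(ρ̄, S̄)`, `σ' T < r₀`, `τ ∈ [0, T)`, and
suppose the solution is at rest on the closed cone slices `‖x - x₀‖ ≤ r₀ - σ' t` for
`t ∈ [0, τ]`. Then the same holds up to some `τ₂ ∈ (τ, T]`: by uniform continuity on the compact
cone the speed bound `‖u‖ + c ≤ σ'` persists slightly beyond `τ`, so the local energy inequality
`E' ≤ C E` with `E(τ) = 0` forces `E ≡ 0` (`eq_zero_of_deriv_le_mul`), hence the rest state on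
the open slices (`rest_of_coneEnergy_eq_zero`) and on the closed ones (Sideris 1984,
Proposition; John, *PDE*, Ch. 5 §3). [folklore] -/
theorem rest_step (h : IsPolytropicC1Solution A γ (Ici 0) ρ u S) (hA : 0 < A) (hγ : 0 < γ)
    (hρbar : 0 < ρbar) (hσ' : 0 < σ') (hσ : soundSpeed A γ ρbar Sbar < σ') {T τ : ℝ}
    (hT : σ' * T < r₀) (hτ : τ ∈ Ico 0 T)
    (hrest : ∀ t ∈ Icc 0 τ, ∀ x, ‖x - x₀‖ ≤ r₀ - σ' * t →
      ρ t x = ρbar ∧ u t x = 0 ∧ S t x = Sbar) :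
    ∃ τ₂ ∈ Ioc τ T, ∀ t ∈ Icc 0 τ₂, ∀ x, ‖x - x₀‖ ≤ r₀ - σ' * t →
      ρ t x = ρbar ∧ u t x = 0 ∧ S t x = Sbar := by
  obtain ⟨ε, hε, hmargin⟩ := exists_speed_margin (A := A) (γ := γ) hρbar hσ
  -- the compact truncated cone `K` and the compact cylinder `K'`
  set K : Set (ℝ × E3) := {p | p.1 ∈ Icc 0 T ∧ ‖p.2 - x₀‖ ≤ r₀ - σ' * p.1} with hK_def
  have hK'c : IsCompact (Icc (0 : ℝ) T ×ˢ closedBall x₀ r₀) :=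
    isCompact_Icc.prod (isCompact_closedBall x₀ r₀)
  have hKsub' : K ⊆ Icc (0 : ℝ) T ×ˢ closedBall x₀ r₀ := by
    rintro ⟨t, x⟩ ⟨ht, hx⟩
    refine mk_mem_prod ht ?_
    rw [mem_closedBall, dist_eq_norm]
    have : 0 ≤ σ' * t := mul_nonneg hσ'.le ht.1
    simp only at hx
    linarith
  have hKclosed : IsClosed K := by
    have h1 : IsClosed {p : ℝ × E3 | p.1 ∈ Icc 0 T} := isClosed_Icc.preimage continuous_fst
    have h2 : IsClosed {p : ℝ × E3 | ‖p.2 - x₀‖ ≤ r₀ - σ' * p.1} :=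
      isClosed_le ((continuous_snd.sub continuous_const).norm)
        (continuous_const.sub (continuous_const.mul continuous_fst))
    exact h1.inter h2
  have hKc : IsCompact K := hK'c.of_isClosed_subset hKclosed hKsub'
  have hKsub : K ⊆ Ici (0 : ℝ) ×ˢ (univ : Set E3) := fun p hp => mk_mem_prod hp.1.1 (mem_univ _)
  -- uniform continuity of the state on `K`
  set U : ℝ × E3 → ℝ × E3 × ℝ := fun p => (ρ p.1 p.2, u p.1 p.2, S p.1 p.2) with hU_def
  have hUc : ContinuousOn U (Ici 0 ×ˢ univ) :=
    h.contDiffOn_density.continuousOn.prodMk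
      (h.contDiffOn_velocity.continuousOn.prodMk h.contDiffOn_entropy.continuousOn)
  obtain ⟨δ, hδ, hUδ⟩ := Metric.uniformContinuousOn_iff.1
    (hKc.uniformContinuousOn_of_continuous (hUc.mono hKsub)) ε hε
  -- the new time `τ₂`
  set τ₂ := min (τ + δ / 2) T with hτ₂
  have hττ₂ : τ < τ₂ := lt_min (by linarith) hτ.2
  have hτ₂T : τ₂ ≤ T := min_le_right _ _
  refine ⟨τ₂, ⟨hττ₂, hτ₂T⟩, ?_⟩
  -- the speed bound on the cone slices for `t ∈ [τ, τ₂]`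
  have hspeed : ∀ t ∈ Icc τ τ₂, ∀ x, ‖x - x₀‖ ≤ r₀ - σ' * t →
      ‖u t x‖ + soundSpeed A γ (ρ t x) (S t x) ≤ σ' := by
    intro t ht x hx
    have htK : (t, x) ∈ K := ⟨⟨hτ.1.trans ht.1, ht.2.trans hτ₂T⟩, hx⟩
    have hτK : (τ, x) ∈ K := by
      refine ⟨⟨hτ.1, hτ.2.le⟩, ?_⟩
      have : σ' * τ ≤ σ' * t := mul_le_mul_of_nonneg_left ht.1 hσ'.le
      simp only
      linarith
    have hdist : dist (t, x) (τ, x) < δ := by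
      rw [Prod.dist_eq, dist_self, max_eq_left dist_nonneg, Real.dist_eq, abs_of_nonneg
        (by linarith [ht.1])]
      have : t ≤ τ + δ / 2 := ht.2.trans (min_le_left _ _)
      linarith
    have hclose := hUδ (t, x) htK (τ, x) hτK hdist
    obtain ⟨h1, h2, h3⟩ := hrest τ ⟨hτ.1, le_rfl⟩ x hτK.2
    simp only [hU_def, h1, h2, h3, Prod.dist_eq, max_lt_iff, Real.dist_eq, dist_zero_right] at hclose
    exact hmargin _ _ _ hclose.1 hclose.2.2 hclose.2.1
  -- a bound for `div u` on the cylinder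
  obtain ⟨M, hM⟩ := hK'c.exists_bound_of_continuousOn
    ((continuousOn_divergence_velocity h).mono (prod_mono Icc_subset_Ici_self (subset_univ _)))
  -- the energy vanishes on `[τ, τ₂]`
  have hTr : σ' * T ≤ r₀ := hT.le
  have hE0 : ∀ t ∈ Icc τ τ₂, coneEnergy A γ ρbar Sbar ρ u S x₀ r₀ σ' t = 0 := by
    refine eq_zero_of_deriv_le_mul (C := (γ + 1) * M)
      (f' := fun t => ∫ x, deriv (fun s => coneWeight x₀ r₀ σ' s x *
        energyDensity A γ ρbar Sbar (ρ s x) (u s x) (S s x)) t) ?_ ?_ ?_ ?_ ?_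
    · exact (continuousOn_coneEnergy h hA hγ hσ'.le hTr).mono
        (Icc_subset_Icc hτ.1 hτ₂T)
    · intro t ht
      exact hasDerivAt_coneEnergy h hA hγ hσ'.le hTr ⟨hτ.1.trans_lt ht.1, ht.2.trans_le hτ₂T⟩
    · intro t ht
      have ht0 : 0 < t := hτ.1.trans_lt ht.1
      have htr : σ' * t < r₀ :=
        lt_of_le_of_lt (mul_le_mul_of_nonneg_left (ht.2.le.trans hτ₂T) hσ'.le) hT
      refine integral_deriv_coneIntegrand_le h hA hγ hσ' ht0 htr
        (hspeed t ⟨ht.1.le, ht.2.le⟩) fun x hx => ?_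
      have := hM (t, x) (mk_mem_prod ⟨ht0.le, ht.2.le.trans hτ₂T⟩ hx)
      simpa [Real.norm_eq_abs] using this
    · exact fun t ht => coneEnergy_nonneg h hA hγ (hτ.1.trans ht.1)
    · have : 0 ≤ r₀ - σ' * τ := by nlinarith [hτ.1, hτ.2]
      exact coneEnergy_eq_zero_of_rest this (hrest τ ⟨hτ.1, le_rfl⟩)
  -- conclusion
  intro t ht x hx
  by_cases htτ : t ≤ τ
  · exact hrest t ⟨ht.1, htτ⟩ x hx
  · have ht' : t ∈ Icc τ τ₂ := ⟨(not_le.1 htτ).le, ht.2⟩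
    have htr : σ' * t ≤ r₀ := (mul_le_mul_of_nonneg_left (ht.2.trans hτ₂T) hσ'.le).trans hTr
    have hr : 0 < r₀ - σ' * t := by
      have : σ' * t < r₀ := lt_of_le_of_lt (mul_le_mul_of_nonneg_left (ht.2.trans hτ₂T) hσ'.le) hT
      linarith
    refine rest_closedBall_of_ball h ht.1 hr (fun y hy => ?_) x hx
    exact rest_of_coneEnergy_eq_zero h hA hγ hρbar hσ'.le ht.1 htr (hE0 t ht') hy

/-- **The cone lemma (domain of dependence).** If `σ' > c(ρ̄, S̄)`, `σ' T < r₀`, and the data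
are at rest on the closed ball `‖x - x₀‖ ≤ r₀`, then the solution is at rest on every closed
cone slice `‖x - x₀‖ ≤ r₀ - σ' t`, `t ∈ [0, T)` — continuous induction in time on the set of
`τ` up to which (strictly) the slices are at rest, which is closed, contains `0`, and is open to
the right by `rest_step` and left-continuity (Sideris 1984, Proposition). [folklore] -/
theorem rest_on_cone (h : IsPolytropicC1Solution A γ (Ici 0) ρ u S) (hA : 0 < A) (hγ : 0 < γ)
    (hρbar : 0 < ρbar) (hσ' : 0 < σ') (hσ : soundSpeed A γ ρbar Sbar < σ') {T : ℝ}
    (hT : σ' * T < r₀)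
    (h0 : ∀ x, ‖x - x₀‖ ≤ r₀ → ρ 0 x = ρbar ∧ u 0 x = 0 ∧ S 0 x = Sbar) :
    ∀ t ∈ Ico 0 T, ∀ x, ‖x - x₀‖ ≤ r₀ - σ' * t → ρ t x = ρbar ∧ u t x = 0 ∧ S t x = Sbar := by
  -- the induction set: rest on all closed slices at times `< θ`
  set s : Set ℝ := {θ | ∀ t, 0 ≤ t → t < θ → ∀ x, ‖x - x₀‖ ≤ r₀ - σ' * t →
    ρ t x = ρbar ∧ u t x = 0 ∧ S t x = Sbar} with hs_def
  -- `s` is closed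
  have hs_closed : IsClosed s := by
    have : s = ⋂ (t : ℝ) (x : E3), {θ | (0 ≤ t ∧ ‖x - x₀‖ ≤ r₀ - σ' * t ∧
        ¬ (ρ t x = ρbar ∧ u t x = 0 ∧ S t x = Sbar)) → θ ≤ t} := by
      ext θ
      simp only [hs_def, mem_setOf_eq, mem_iInter]
      constructor
      · intro hθ t x ⟨ht, hx, hn⟩
        by_contra hlt
        exact hn (hθ t ht (not_le.1 hlt) x hx)
      · intro hθ t ht htθ x hx
        by_contra hn
        exact absurd (hθ t x ⟨ht, hx, hn⟩) (not_le.2 htθ)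
    rw [this]
    refine isClosed_iInter fun t => isClosed_iInter fun x => ?_
    by_cases hc : (0 ≤ t ∧ ‖x - x₀‖ ≤ r₀ - σ' * t ∧ ¬ (ρ t x = ρbar ∧ u t x = 0 ∧ S t x = Sbar))
    · have hset : {θ : ℝ | (0 ≤ t ∧ ‖x - x₀‖ ≤ r₀ - σ' * t ∧
          ¬ (ρ t x = ρbar ∧ u t x = 0 ∧ S t x = Sbar)) → θ ≤ t} = Iic t := by
        ext θ
        simp only [mem_setOf_eq, mem_Iic]
        exact ⟨fun h' => h' hc, fun h' _ => h'⟩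
      rw [hset]
      exact isClosed_Iic
    · have hset : {θ : ℝ | (0 ≤ t ∧ ‖x - x₀‖ ≤ r₀ - σ' * t ∧
          ¬ (ρ t x = ρbar ∧ u t x = 0 ∧ S t x = Sbar)) → θ ≤ t} = univ :=
        eq_univ_of_forall fun θ h' => absurd h' hc
      rw [hset]
      exact isClosed_univ
  -- `0 ∈ s` (vacuously)
  have h0s : (0 : ℝ) ∈ s := fun t ht ht0 => absurd ht0 (not_lt.2 ht)
  -- from the strict to the closed version at a time `θ`, by left-continuity
  have hupgrade : ∀ θ, 0 ≤ θ → θ ∈ s → ∀ t ∈ Icc 0 θ, ∀ x, ‖x - x₀‖ ≤ r₀ - σ' * t →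
      ρ t x = ρbar ∧ u t x = 0 ∧ S t x = Sbar := by
    intro θ hθ0 hθ t ht x hx
    rcases ht.2.lt_or_eq with hlt | heq
    · exact hθ t ht.1 hlt x hx
    · subst heq
      rcases hθ0.lt_or_eq with hpos | hzero
      · -- left-continuity at `t > 0`
        have hprev : ∀ t' ∈ Ico 0 t, ρ t' x = ρbar ∧ u t' x = 0 ∧ S t' x = Sbar := by
          intro t' ht'
          refine hθ t' ht'.1 ht'.2 x (hx.trans ?_)
          nlinarith [ht'.2, hσ']
        have hcρ := (continuousOn_timeLine_of_contDiffOn h.contDiffOn_density x) t (mem_Ici.2 hθ0)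
        have hcu := (continuousOn_timeLine_of_contDiffOn h.contDiffOn_velocity x) t (mem_Ici.2 hθ0)
        have hcS := (continuousOn_timeLine_of_contDiffOn h.contDiffOn_entropy x) t (mem_Ici.2 hθ0)
        exact ⟨eq_of_eqOn_Ico hcρ hpos fun t' ht' => (hprev t' ht').1,
          eq_of_eqOn_Ico hcu hpos fun t' ht' => (hprev t' ht').2.1,
          eq_of_eqOn_Ico hcS hpos fun t' ht' => (hprev t' ht').2.2⟩
      · subst hzero
        exact h0 x (by simpa using hx)
  -- continuous induction
  have hind : Icc 0 T ⊆ s := by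
    refine (hs_closed.inter isClosed_Icc).Icc_subset_of_forall_mem_nhdsWithin h0s ?_
    rintro θ ⟨hθs, hθ⟩
    obtain ⟨τ₂, hτ₂, hrest⟩ := rest_step h hA hγ hρbar hσ' hσ hT hθ (hupgrade θ hθ.1 hθs)
    refine mem_of_superset (Ioc_mem_nhdsGT hτ₂.1) fun θ' hθ' => ?_
    exact fun t ht htθ x hx => hrest t ⟨ht, htθ.le.trans hθ'.2⟩ x hx
  intro t ht x hx
  by_cases hT0 : 0 ≤ T
  · exact hind (right_mem_Icc.2 hT0) t ht.1 ht.2 x hx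
  · exact absurd (ht.1.trans_lt ht.2) (fun h' => hT0 h'.le)

end Cone

/-! ### Discharge of Sideris' Proposition -/

/-- A point is in the closure of the open exterior region beyond its own norm:
`x ∈ closure {y | ‖x‖ < ‖y‖}` for `x ≠ 0` (approach `x` by `c • x`, `c ↓ 1`). [folklore] -/
theorem mem_closure_norm_lt (x : E3) (hx : x ≠ 0) : x ∈ closure {y : E3 | ‖x‖ < ‖y‖} := by
  have hlim : Tendsto (fun c : ℝ => c • x) (𝓝[>] 1) (𝓝 x) := by
    have : Tendsto (fun c : ℝ => c • x) (𝓝 1) (𝓝 ((1 : ℝ) • x)) :=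
      (continuous_id.smul continuous_const).tendsto 1
    rw [one_smul] at this
    exact this.mono_left nhdsWithin_le_nhds
  refine mem_closure_of_tendsto hlim (eventually_nhdsWithin_of_forall fun c hc => ?_)
  have hc1 : (1 : ℝ) < c := hc
  rw [mem_setOf_eq, norm_smul, Real.norm_eq_abs, abs_of_pos (zero_lt_one.trans hc1)]
  have : 0 < ‖x‖ := norm_pos_iff.2 hx
  nlinarith

/-- **Discharge of Sideris' Proposition (finite propagation speed).** For `A > 0`, `γ > 1`,
`R > 0`, `ρ̄ > 0`: a `C¹` solution of (1.1 a–d) on `[0, ∞) × ℝ³` whose data are the rest state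
`(ρ̄, 0, S̄)` for `‖x‖ ≥ R` equals the rest state whenever `‖x‖ ≥ R + σ t`,
`σ = (A γ ρ̄^{γ-1} e^{S̄})^{1/2}`. Proof: for `‖x‖ > R + σ t` pick `σ' > σ` with
`σ' t < ‖x‖ - R =: r₀`; the data are at rest on `‖y - x‖ ≤ r₀` (as `‖y‖ ≥ R` there), so the cone
lemma `rest_on_cone` with tip above `(t, x)` applies; the sphere `‖x‖ = R + σ t` follows by
continuity in `x` (Sideris 1985, §1 Proposition p. 476; Sideris 1984). [cite: Sideris1985, §1 Proposition (p. 476)] -/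
theorem FinitePropagationSpeed_holds : FinitePropagationSpeed := by
  intro A γ R ρbar Sbar hA hγ hR hρbar ρ u S hsol hdata t ht
  have hγ0 : 0 < γ := zero_lt_one.trans hγ
  set σ := farFieldSoundSpeed A γ ρbar Sbar with hσ_def
  have hσc : σ = soundSpeed A γ ρbar Sbar := farFieldSoundSpeed_eq_soundSpeed hρbar
  have hσ0 : 0 ≤ σ := farFieldSoundSpeed_nonneg A γ ρbar Sbar
  -- the open exterior region
  have hopen : ∀ x : E3, R + σ * t < ‖x‖ → ρ t x = ρbar ∧ u t x = 0 ∧ S t x = Sbar := by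
    intro x hx
    set r₀ := ‖x‖ - R with hr₀
    have hr₀t : σ * t < r₀ := by rw [hr₀]; linarith
    have hr₀0 : 0 < r₀ := lt_of_le_of_lt (mul_nonneg hσ0 ht) hr₀t
    -- a cone speed `σ' > σ` with `σ' t < r₀`
    set σ' := σ + (r₀ - σ * t) / (2 * (t + 1)) with hσ'
    have ht1 : 0 < 2 * (t + 1) := by linarith
    have hσσ' : σ < σ' := by
      rw [hσ']
      have : 0 < (r₀ - σ * t) / (2 * (t + 1)) := div_pos (by linarith) ht1
      linarith
    have hσ'0 : 0 < σ' := lt_of_le_of_lt hσ0 hσσ'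
    have hσ't : σ' * t < r₀ := by
      rw [hσ', add_mul]
      have h1 : (r₀ - σ * t) / (2 * (t + 1)) * t ≤ (r₀ - σ * t) / 2 := by
        rw [div_mul_eq_mul_div, div_le_div_iff₀ ht1 two_pos]
        nlinarith
      linarith
    -- a final time `T` with `t < T`, `σ' T < r₀`
    set T := (t + r₀ / σ') / 2 with hT
    have htT : t < T := by
      rw [hT]
      have : t < r₀ / σ' := by rw [lt_div_iff₀ hσ'0]; linarith
      linarith
    have hσ'T : σ' * T < r₀ := by
      rw [hT]
      have : σ' * (r₀ / σ') = r₀ := by field_simp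
      nlinarith
    -- the data are at rest on the base ball `‖y - x‖ ≤ r₀`
    have h0 : ∀ y : E3, ‖y - x‖ ≤ r₀ → ρ 0 y = ρbar ∧ u 0 y = 0 ∧ S 0 y = Sbar := by
      intro y hy
      refine hdata y ?_
      have h1 := norm_sub_norm_le x y
      rw [norm_sub_rev] at h1
      linarith
    have key := rest_on_cone (x₀ := x) hsol hA hγ0 hρbar hσ'0 (hσc ▸ hσσ') hσ'T h0 t ⟨ht, htT⟩ x
    exact key (by simp; linarith)
  -- the boundary sphere by continuity
  intro x hx
  rcases hx.lt_or_eq with hlt | heq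
  · exact hopen x hlt
  · have hx0 : x ≠ 0 := by
      rw [← norm_pos_iff, ← heq]
      linarith [mul_nonneg hσ0 ht]
    have hsub : {y : E3 | ‖x‖ < ‖y‖} ⊆ {y : E3 | ρ t y = ρbar ∧ u t y = 0 ∧ S t y = Sbar} :=
      fun y hy => hopen y (by rw [heq]; exact hy)
    exact (isClosed_restSet (ρbar := ρbar) (Sbar := Sbar) hsol ht).closure_subset_iff.2 hsub
      (mem_closure_norm_lt x hx0)

end Literature.Barriers.AtomisticToContinuum.PolytropicEuler

end
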